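import Literature.NumberTheory.Automorphic.Zelevinsky1980.UnitaryCharacterInductionRegular
import Literature.NumberTheory.Automorphic.Zelevinsky1980.RankTwoDetCharSelfIrreducible
import HarnessLib

/-!
# [Zelevinsky1980, Thm. 4.2 (2)⇒(1)] for `(ν₀ ∘ det_{GL_{N-1}}) × χ′`, `ν₀, χ′` unitary — the discharge

Topic `NumberTheory/Automorphic/Zelevinsky1980`; theorems only. The named fact
`Zelevinsky1980.parabolicIndGL_detChar_unitary_isIrreducible` (`ParabolicIndGLDetCharIrreducible`): for a
non-archimedean local field `F`, every `N : ℕ` and UNITARY CONTINUOUS characters `ν₀, χ′ : Fˣ → ℂˣ`, the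
normalised parabolic induction `(ν₀ ∘ det_{GL_{N-1}}) × χ′ = i_{GL_N, G_{(N-1,1)}}((ν₀ ∘ det) ⊠ χ′)`
(`Representation.parabolicIndGL F (lastBlockLabel N) (𝟙.twist (maxParabolicLeviChar F N ν₀ χ′))`) is
IRREDUCIBLE.  The proof is the case split assembled from the tree (cell `hodgecm-mathlib`, row IV-3 (b)):

* `N ≤ 1`: `Q_{N-1,1} = GL_N`, the induced representation is the one-dimensional inducing character
  (`parabolicIndGL_detChar_isIrreducible_of_le_one`, `CharacterInductionDegenerate`);
* `N ≥ 3`, and `N = 2` with `ν₀ ≠ χ′` (REGULAR cases): the two exponents of the `U`-Jacquet module of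
  `I = Ind σ'` differ (`|q σ'(d₀(ϖ))| = q^{1/2} ≠ q^{(N-1)/2} = |σ'(d(ϖ))|`, resp. a uniformizer with
  `ν₀(ϖ) ≠ χ′(ϖ)`), so `End_{GL_N}(I) = ℂ` by the Bruhat filtration of `I|_P`
  (`InducedMaximalParabolicEndomorphisms`, `JacquetOfInducedMaximalParabolic`, `MaximalParabolicOrbitFiltration`),
  and `I` is completely reducible by unitarity (invariant inner product `∫_{K₀} conj f₁ f₂`,
  `InducedCharacterInvariantForm` / `ModulusInvariantIntegral`), hence irreducible
  (`isIrreducible_parabolicIndGL_detChar_of_three_le`, `isIrreducible_parabolicIndGL_detChar_two_of_ne`,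
  file `UnitaryCharacterInductionRegular`);
* `N = 2`, `ν₀ = χ′` (IRREGULAR case `χ × χ`, equal exponents): `End = ℂ` from the non-semisimplicity of the
  Jacquet module, witnessed on the unit shell `Φ_{K₀} − Φ_{K₁}` of the open cell
  (`parabolicIndGL_two_detChar_self_isIrreducible`, files `RankTwoUnitShell`,
  `RankTwoInducedEndomorphismsIrregular`, `RankTwoDetCharSelfIrreducible`).

## References

* A. V. Zelevinsky, *Induced representations of reductive p-adic groups II. On irreducible representations
  of GL(n)*, Ann. Sci. ÉNS 13 (1980), Thm. 4.2 (p. 184) with §3.2 Example (p. 181). [Zelevinsky1980]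
* I. N. Bernstein, A. V. Zelevinsky, *Induced representations of reductive p-adic groups I*,
  Ann. Sci. ÉNS 10 (1977), Thm. 5.2, §7.1. [BernsteinZelevinskyASENS1977]
-/

noncomputable section

namespace Literature.NumberTheory.Automorphic.Zelevinsky1980

universe u

/-- **[Zelevinsky1980, Thm. 4.2 (2)⇒(1), p. 184, with §3.2 Example p. 181] — `(ν₀ ∘ det_{GL_{N-1}}) × χ′` is
irreducible for unitary continuous `ν₀, χ′` and every `N`**: the discharge of the named fact
`parabolicIndGL_detChar_unitary_isIrreducible`, by the case split `N ≤ 1` (degenerate), `N = 2` with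
`ν₀ = χ′` (irregular rank two) / `ν₀ ≠ χ′`, and `N ≥ 3` (regular: distinct Jacquet exponents + unitarity).
[cite: Zelevinsky1980, Thm. 4.2 (2)⇒(1), p. 184 (with §3.2 Example, p. 181)] -/
theorem parabolicIndGL_detChar_unitary_isIrreducible_holds : parabolicIndGL_detChar_unitary_isIrreducible.{u} := by
  intro F _ _ _ _ N _ ν₀ χ' hν₀u hν₀c hχ'u hχ'c
  rcases Nat.lt_or_ge N 3 with hN | hN
  · interval_cases N
    · exact parabolicIndGL_detChar_isIrreducible_of_le_one F 0 (by omega) ν₀ χ' hν₀c hχ'c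
    · exact parabolicIndGL_detChar_isIrreducible_of_le_one F 1 (by omega) ν₀ χ' hν₀c hχ'c
    · by_cases h : ν₀ = χ'
      · subst h
        exact parabolicIndGL_two_detChar_self_isIrreducible F ν₀ hν₀u hν₀c
      · exact isIrreducible_parabolicIndGL_detChar_two_of_ne ν₀ χ' h hν₀u hν₀c hχ'u hχ'c
  · exact isIrreducible_parabolicIndGL_detChar_of_three_le N hN ν₀ χ' hν₀u hν₀c hχ'u hχ'c

end Literature.NumberTheory.Automorphic.Zelevinsky1980

end
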